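import Mathlib.Analysis.InnerProductSpace.LinearMap
import Mathlib.Analysis.Normed.Operator.Extend
import Mathlib.LinearAlgebra.Finsupp.LinearCombination
import Mathlib.Topology.Algebra.Module.Basic
import HarnessLib

/-!
# Total families with equal Gram matrices are unitarily equivalent (the GNS / Kolmogorov uniqueness in family form)

Topic `RepresentationTheory/Unitary`; namespace `Literature.RepresentationTheory.Unitary`.

`CyclicCoefficientRigidity` proves: two cyclic vectors of isometric representations with the same diagonal
coefficient are exchanged by a unitary intertwiner.  The underlying Hilbert-space fact, isolated here in the form
needed when the generating set is not a single orbit (e.g. the translates `W(x) m`, `m` in the vacuum subspace, of a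
Weyl system — `HeisenbergGroup/WeylSystemVacuumSubspace`):

* `inner_linearCombination_eq_of_inner_eq`, `norm_linearCombination_eq_of_inner_eq` — two families
  `f₁ : ι → E₁`, `f₂ : ι → E₂` with the same Gram matrix `⟪f₁ i, f₁ j⟫ = ⟪f₂ i, f₂ j⟫` have combinations
  `∑ cᵢ f₁ i`, `∑ cᵢ f₂ i` with equal inner products and norms;
* **`exists_linearIsometryEquiv_of_inner_eq`** — if moreover both families are TOTAL (dense span), there is a
  unitary `U : E₁ ≃ₗᵢ[ℂ] E₂` with `U (f₁ i) = f₂ i` for all `i` (Mathlib `LinearEquiv.extendOfIsometry` along the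
  combination maps `(ι →₀ ℂ) → Eₖ`);
* `continuousLinearMap_eq_of_eqOn_of_dense` — such a `U` is unique (two continuous linear maps agreeing on a total
  family are equal).

This is the uniqueness part of the Kolmogorov–GNS dilation of a positive-definite kernel
(Dixmier, *C\\*-algebras*, Prop. 2.4.1 (ii); the kernel form is folklore, e.g. Paulsen–Raghupathi Thm 2.14).
Everything is PROVED (Mathlib only).

## References

* [Dixmier1977] J. Dixmier, *C\\*-algebras*, North-Holland, 1977, Prop. 2.4.1 (ii), §13.1.3.
-/

noncomputable section

open scoped InnerProductSpace ComplexConjugate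

namespace Literature.RepresentationTheory.Unitary

variable {ι : Type*}
  {E₁ : Type*} [NormedAddCommGroup E₁] [InnerProductSpace ℂ E₁]
  {E₂ : Type*} [NormedAddCommGroup E₂] [InnerProductSpace ℂ E₂]

/-- **equal Gram matrices ⇒ equal inner products of combinations.** [cite: Dixmier1977, Prop. 2.4.1 (ii)] -/
theorem inner_linearCombination_eq_of_inner_eq (f₁ : ι → E₁) (f₂ : ι → E₂)
    (hgram : ∀ i j, ⟪f₁ i, f₁ j⟫_ℂ = ⟪f₂ i, f₂ j⟫_ℂ) (c d : ι →₀ ℂ) :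
    ⟪Finsupp.linearCombination ℂ f₁ c, Finsupp.linearCombination ℂ f₁ d⟫_ℂ =
      ⟪Finsupp.linearCombination ℂ f₂ c, Finsupp.linearCombination ℂ f₂ d⟫_ℂ := by
  simp only [Finsupp.linearCombination_apply, Finsupp.sum, sum_inner, inner_sum, inner_smul_left,
    inner_smul_right, hgram]

/-- **equal Gram matrices ⇒ equal norms of combinations.** [cite: Dixmier1977, Prop. 2.4.1 (ii)] -/
theorem norm_linearCombination_eq_of_inner_eq (f₁ : ι → E₁) (f₂ : ι → E₂)
    (hgram : ∀ i j, ⟪f₁ i, f₁ j⟫_ℂ = ⟪f₂ i, f₂ j⟫_ℂ) (c : ι →₀ ℂ) :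
    ‖Finsupp.linearCombination ℂ f₁ c‖ = ‖Finsupp.linearCombination ℂ f₂ c‖ := by
  rw [norm_eq_sqrt_re_inner (𝕜 := ℂ), norm_eq_sqrt_re_inner (𝕜 := ℂ) (Finsupp.linearCombination ℂ f₂ c),
    inner_linearCombination_eq_of_inner_eq f₁ f₂ hgram]

variable [CompleteSpace E₁] [CompleteSpace E₂]

/-- **Total families with equal Gram matrices are unitarily equivalent**: if `⟪f₁ i, f₁ j⟫ = ⟪f₂ i, f₂ j⟫` for all
`i, j` and both families span dense subspaces of their Hilbert spaces, there is a unitary `U : E₁ ≃ₗᵢ[ℂ] E₂` with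
`U (f₁ i) = f₂ i` (the map `∑ cᵢ f₁ i ↦ ∑ cᵢ f₂ i` is well defined and isometric, and extends to the closures).
[cite: Dixmier1977, Prop. 2.4.1 (ii)] -/
theorem exists_linearIsometryEquiv_of_inner_eq (f₁ : ι → E₁) (f₂ : ι → E₂)
    (hgram : ∀ i j, ⟪f₁ i, f₁ j⟫_ℂ = ⟪f₂ i, f₂ j⟫_ℂ)
    (hd₁ : Dense (Submodule.span ℂ (Set.range f₁) : Set E₁))
    (hd₂ : Dense (Submodule.span ℂ (Set.range f₂) : Set E₂)) :
    ∃ U : E₁ ≃ₗᵢ[ℂ] E₂, ∀ i, U (f₁ i) = f₂ i := by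
  set Φ₁ : (ι →₀ ℂ) →ₗ[ℂ] E₁ := Finsupp.linearCombination ℂ f₁ with hΦ₁
  set Φ₂ : (ι →₀ ℂ) →ₗ[ℂ] E₂ := Finsupp.linearCombination ℂ f₂ with hΦ₂
  have hr₁ : DenseRange Φ₁ := by
    show Dense (Set.range Φ₁)
    rw [← LinearMap.coe_range, hΦ₁, Finsupp.range_linearCombination]
    exact hd₁
  have hr₂ : DenseRange Φ₂ := by
    show Dense (Set.range Φ₂)
    rw [← LinearMap.coe_range, hΦ₂, Finsupp.range_linearCombination]
    exact hd₂
  have hnorm : ∀ c : ι →₀ ℂ, ‖Φ₂ (LinearEquiv.refl ℂ (ι →₀ ℂ) c)‖ = ‖Φ₁ c‖ := fun c =>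
    (norm_linearCombination_eq_of_inner_eq f₁ f₂ hgram c).symm
  refine ⟨(LinearEquiv.refl ℂ (ι →₀ ℂ)).extendOfIsometry Φ₁ Φ₂ hr₁ hr₂ hnorm, fun i => ?_⟩
  have h := LinearEquiv.extendOfIsometry_eq _ _ _ hr₁ hr₂ hnorm (Finsupp.single i 1)
  simp only [hΦ₁, hΦ₂, LinearEquiv.refl_apply, Finsupp.linearCombination_single, one_smul] at h
  exact h

omit [CompleteSpace E₁] [CompleteSpace E₂] in
/-- **Uniqueness**: two continuous linear maps `E₁ → E₂` agreeing on a total family are equal; in particular the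
unitary of `exists_linearIsometryEquiv_of_inner_eq` is unique. [cite: Dixmier1977, Prop. 2.4.1 (ii)] -/
theorem continuousLinearMap_eq_of_eqOn_of_dense (f₁ : ι → E₁)
    (hd₁ : Dense (Submodule.span ℂ (Set.range f₁) : Set E₁)) (U U' : E₁ →L[ℂ] E₂)
    (h : ∀ i, U (f₁ i) = U' (f₁ i)) : U = U' := by
  refine ContinuousLinearMap.ext_on hd₁ ?_
  rintro _ ⟨i, rfl⟩
  exact h i

end Literature.RepresentationTheory.Unitary

end
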